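import Summits.AnomalousDissipation.AnomalousDissipation.Theorems.SolenoidalFractalHomogenisationLagrangianStepSidebandLadderCrushNu
import HarnessLib

/-!
# K1L_D `stub_D1_V0thg` (stmt-AnomalousDissipation-27980), R3′ lane «SidebandTailCrushing» — file F4h∘F5 (v): the FULL-SLOT ν-scaled ladder crush
# (contraction before and after the half-height window; ladder invariance from the slot start) — the shape of the R3′ plan memo's §4
# `Sideband.ladder_crush` ν-signature, squared

Helper file of route `SolenoidalFractalHomogenisation` (`--supports stmt-AnomalousDissipation-27980 --as helper`; one-generation hand
`leafhand-ad-solenoidalfractalh-1` g0, road E-c).  `ladder_crush_slot_nu`: for a solution `u` of the truncated sideband system `u′ = gen(t)u` on the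
whole CLOSED slot `[startᵢ, startᵢ + τᵢ]` that starts (at `startᵢ`) in the ladder subspace of the hopping ladder `z₀ + ℤmᵢ` (`êᵢ·z₀ ≠ 0`, box radius
`R > M ≥ ‖mᵢ‖_∞`), in the (V)-clause window `NearIso 𝔸 (νl) (νh)`, `OddSmall 𝔸 (νβ)` written with `r = ν^{1/3} ∈ (0,1]` (`ν = r³`), under the
odd-viscosity feasibility `128(β(1+Mo)/(2l))² ≤ S₀`, the box condition `C_R ≤ (R − M)r²` and `2/r ≤ τᵢ`:
`‖u(startᵢ + τᵢ)‖² ≤ 3(1 + 7S₀κ²/(8π²l))·e^{c}·exp(−c·r²·τᵢ/2)·‖u(startᵢ)‖²` with the explicit ν-free `c > 0` of `ladder_crush_halfslot_nu`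
— the flow is a contraction on `[startᵢ, startᵢ + τᵢ/4]` and `[startᵢ + 3τᵢ/4, startᵢ + τᵢ]` (`Sideband.norm_le_of_hasDerivAt_gen`), the ladder
subspace is invariant while the other envelopes are off (`Sideband.mem_ladderSub_of_flow`), and `ladder_crush_halfslot_nu` crushes across the
half-height window.  For the quasi-statically stretched slot `τᵢ = τᵢ⁰MB/ν` the factor is `exp(−(c/2)τᵢ⁰MB·ν^{−1/3})`.  Remaining for R3′-2 (not
here): the spine `D1TailCrushTable/Bound/Cert` over the path classes of `SidebandPathCensus`.  No definitions, no sorry.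
NOT a proof of `stub_D1_V0thg`, of K1L_D or of AD; rung F-D1.A0 infrastructure.
-/

set_option linter.dupNamespace false -- single-conjunct summit: `Summit.AnomalousDissipation.AnomalousDissipation.…` is the mandated namespace

noncomputable section

namespace Summit.AnomalousDissipation.AnomalousDissipation.Theorems.SolenoidalFractalHomogenisation.LagrangianStep.Sideband

open Set Complex
open scoped InnerProductSpace
open Literature.Analysis Literature.Analysis.FunctionSpaces Literature.Analysis.FunctionSpaces.Torus
open Literature.Analysis.FluidPDE Literature.Analysis.FluidPDE.Torus Literature.Analysis.FluidPDE.LatticeShear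

variable {k₀ : ℕ}

set_option maxHeartbeats 400000 in -- pre-budgeted (ops-buildfix rule): large statement
/-- **FULL-SLOT ν-SCALED LADDER CRUSH** (`ladder_crush_halfslot_nu` + contraction outside the half-height window + ladder invariance from the slot
start): `‖u(startᵢ + τᵢ)‖² ≤ 3(1 + 7S₀κ²/(8π²l))·e^{c}·exp(−c r² τᵢ/2)·‖u(startᵢ)‖²` (dictionary as in `ladder_crush_halfslot_nu`).
[cite: BedrossianCotiZelati2017, §2 (hypocoercivity, enhanced dissipation)] [cite: Avron1998OddViscosity, §2 eq. (1)-(2)] -/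
theorem ladder_crush_slot_nu (W₁ : LatticeWord k₀) {R : ℕ} (i : Fin k₀) (z₀ : Fin 3 → ℤ)
    (hhop : ∑ a, (W₁.phase i).e a * (z₀ a : ℝ) ≠ 0) {M : ℝ} (hM : ∀ j, |((W₁.phase i).m j : ℝ)| ≤ M) (hMR : M < R)
    {r l h β : ℝ} (hr : 0 < r) (hr1 : r ≤ 1) (hl : 0 < l) (hh : 0 < h) (hβ : 0 ≤ β)
    {𝔸 : Torus.Visc4 (Fin 3)} (h𝔸 : Torus.NearIso 𝔸 (r ^ 3 * l) (r ^ 3 * h)) (hoddA : Torus.OddSmall 𝔸 (r ^ 3 * β)) {γ₁ : ℝ} (hγ₁ : 0 ≤ γ₁)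
    {u : ℝ → Space R} (hτ : 2 / r ≤ (W₁.phase i).τ)
    (hu : ∀ t ∈ Icc (W₁.start i) (W₁.start i + (W₁.phase i).τ), HasDerivAt u (((gen W₁ 𝔸 γ₁ R t).restrictScalars ℝ) (u t)) t)
    (h0 : u (W₁.start i) ∈ ladderSub R (ladder z₀ (W₁.phase i).m))
    -- the ν-free abbreviations (instantiate with `rfl`) and the cube root `κ` of `4π²l/(28S₀²)`
    {a m₂ S₀ Mo κ CR K₁ K₃ c : ℝ} (ha0 : 0 < a)
    (ha : a = 2 * Real.pi * |∑ a, (W₁.phase i).e a * (z₀ a : ℝ)| * ‖slotAmp W₁ i‖)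
    (hm₂ : m₂ = freqNormSq (W₁.phase i).m)
    (hS₀ : S₀ = 4 * (4 * a ^ 2) + 16 * (8 * a ^ 2 * (1 + m₂) * h / l) + 1)
    (hMo : Mo = 8 * a ^ 2 * (1 + m₂)) (hκ0 : 0 < κ) (hκ3 : κ ^ 3 = 4 * Real.pi ^ 2 * l / (28 * S₀ ^ 2))
    (hCR : CR = 24 * κ * a ^ 2 / (Real.pi ^ 2 * l))
    (hK₁ : K₁ = (1 + m₂) / (4 * a ^ 2) * (2 + 2 * a ^ 2))
    (hK₃ : K₃ = (1 + m₂) / (4 * a ^ 2) * (6 * a ^ 2 / (4 * Real.pi ^ 2 * l * CR) + 4 * a ^ 2 / (4 * Real.pi ^ 2 * l * CR ^ 2)))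
    (hc : c = min (2 * Real.pi ^ 2 * l / (21 * S₀ * κ ^ 2)) (min (4 * Real.pi ^ 2 * l * a ^ 2 / (21 * (1 + m₂))) (min (1 / (6 * K₃)) (κ / (3 * K₁)))))
    (hF : 128 * (β / (2 * l) * (1 + Mo)) ^ 2 ≤ S₀) (hbox : CR ≤ ((R : ℝ) - M) * r ^ 2) :
    0 < c ∧ ‖u (W₁.start i + (W₁.phase i).τ)‖ ^ 2 ≤
      3 * (1 + 7 * S₀ * κ ^ 2 / (8 * Real.pi ^ 2 * l)) * Real.exp c * Real.exp (-(c * r ^ 2 * ((W₁.phase i).τ / 2))) *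
        ‖u (W₁.start i)‖ ^ 2 := by
  have hτ0 : 0 < (W₁.phase i).τ := (W₁.phase i).τ_pos
  have hlo' : 0 ≤ r ^ 3 * l := by positivity
  set s := W₁.start i with hs
  set τ := (W₁.phase i).τ with hτdef
  -- restrictions of the ODE to the three pieces of the slot
  have hu1 : ∀ t ∈ Icc s (s + τ / 4), HasDerivAt u (((gen W₁ 𝔸 γ₁ R t).restrictScalars ℝ) (u t)) t :=
    fun t ht => hu t ⟨ht.1, by linarith [ht.2]⟩
  have hu2 : ∀ t ∈ Icc (s + τ / 4) (s + 3 * τ / 4), HasDerivAt u (((gen W₁ 𝔸 γ₁ R t).restrictScalars ℝ) (u t)) t :=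
    fun t ht => hu t ⟨by linarith [ht.1], by linarith [ht.2]⟩
  have hu3 : ∀ t ∈ Icc (s + 3 * τ / 4) (s + τ), HasDerivAt u (((gen W₁ 𝔸 γ₁ R t).restrictScalars ℝ) (u t)) t :=
    fun t ht => hu t ⟨by linarith [ht.1], ht.2⟩
  -- ladder invariance on the first quarter (inside the open slot the other envelopes are off)
  have hoff1 : ∀ t ∈ Icc s (s + τ / 4), ∀ j, j ≠ i → slotEnvelope W₁ j t = 0 :=
    fun t ht j hj => slotEnvelope_eq_zero_of_mem_slot W₁ hj ⟨ht.1, by linarith [ht.2]⟩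
  have h0' : u (s + τ / 4) ∈ ladderSub R (ladder z₀ (W₁.phase i).m) :=
    mem_ladderSub_of_flow W₁ i z₀ h𝔸 hlo' hγ₁ hu1 hoff1 h0 (s + τ / 4) ⟨by linarith, le_rfl⟩
  -- the crush across the half-height window
  obtain ⟨hc0, hmid⟩ := ladder_crush_halfslot_nu W₁ i z₀ hhop hM hMR hr hr1 hl hh hβ h𝔸 hoddA hγ₁ hτ hu2 h0' ha0 ha hm₂ hS₀ hMo hκ0 hκ3
    hCR hK₁ hK₃ hc hF hbox
  refine ⟨hc0, ?_⟩
  -- contraction before and after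
  have hc1 : ‖u (s + τ / 4)‖ ≤ ‖u s‖ := norm_le_of_hasDerivAt_gen W₁ h𝔸 hlo' hγ₁ R (by linarith) hu1
  have hc3 : ‖u (s + τ)‖ ≤ ‖u (s + 3 * τ / 4)‖ := norm_le_of_hasDerivAt_gen W₁ h𝔸 hlo' hγ₁ R (by linarith) hu3
  have hK : 0 ≤ 3 * (1 + 7 * S₀ * κ ^ 2 / (8 * Real.pi ^ 2 * l)) * Real.exp c * Real.exp (-(c * r ^ 2 * (τ / 2))) := by
    have hS₀0 : 0 < S₀ := by
      rw [hS₀]; have := hm₂ ▸ freqNormSq_nonneg (W₁.phase i).m; positivity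
    positivity
  calc ‖u (s + τ)‖ ^ 2 ≤ ‖u (s + 3 * τ / 4)‖ ^ 2 := pow_le_pow_left₀ (norm_nonneg _) hc3 2
    _ ≤ 3 * (1 + 7 * S₀ * κ ^ 2 / (8 * Real.pi ^ 2 * l)) * Real.exp c * Real.exp (-(c * r ^ 2 * (τ / 2))) * ‖u (s + τ / 4)‖ ^ 2 := hmid
    _ ≤ 3 * (1 + 7 * S₀ * κ ^ 2 / (8 * Real.pi ^ 2 * l)) * Real.exp c * Real.exp (-(c * r ^ 2 * (τ / 2))) * ‖u s‖ ^ 2 :=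
        mul_le_mul_of_nonneg_left (pow_le_pow_left₀ (norm_nonneg _) hc1 2) hK

end Summit.AnomalousDissipation.AnomalousDissipation.Theorems.SolenoidalFractalHomogenisation.LagrangianStep.Sideband

end
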